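import Mathlib
import Summits.ResolutionOfSingularities.ResolutionOfSingularities.Theorems.WeightedInvariantLocalWeightedDropPolyDescentDefs
import Summits.ResolutionOfSingularities.ResolutionOfSingularities.Theorems.WeightedInvariantLocalWeightedDropPureDescentNewton
import Summits.ResolutionOfSingularities.ResolutionOfSingularities.Theorems.WeightedInvariantLocalWeightedDropWildMonicNewtonPointStep
import Summits.ResolutionOfSingularities.ResolutionOfSingularities.Theorems.WeightedInvariantLocalWeightedDropNewtonSetChartVertices

/-!
# `WeightedInvariant.LocalWeightedDrop`, stub S3ρ: the monic polyhedron descent — the `d!`-SCALED NEWTON SET under the four slotwise moves; vertex coefficients, solvability and well-preparedness are CARRIED by the `u₁`-chart (piece ρ-N, part 1)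

Crux item stmt-ResolutionOfSingularities-8899 `LocalWeightedDrop` (route `ResolutionOfSingularities/WeightedInvariant`), registered skeleton v30
(09f812eb3be8b7d8), stub S3ρ `stub_wildMonicSurfaceReductionWon`.  [OURS · L1 W4.3, chain w43, lead prover (gen 3); a LINE UNDER THE STUB: the
monic polyhedron descent (second key to S3ρ, memo `L/res-L1-w43-lead-1/g3/S3RHO-CJS-MEMO.md`), MODEL Cossart–Jannsen–Saito LNM 2270 Ch. 8/11–13 for
`J = (y^d + Σ_{j<d} A_j y^j)`, `e = 2`, `k = k̄`; nothing here is a statement of any manuscript.]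

* `newtonSet_blowOneT/blowTwoT/divOneT/divTwoT` — on stub-7's `WildMonic.newtonSet` (scale `d!/(d−j)` on slot `j`) the slotwise chart maps
  `blowOne (d−j)` / `blowTwo (d−j)` / `divOne (d−j)` / `divTwo (d−j)` act UNIFORMLY as `MonicDescent.psi d!` / `phiE d!` / the shifts by `(d!,0)`, `(0,d!)`
  (positions resp. permissible labels; `WildMonic.smul_psi`);
* `vertexCoeff_blowOneT`, `solvable_blowOneT_iff`, `wellPrepared_blowOneT` — the `u₁`-chart carries vertex coefficients, hence solvability of integral
  points, hence WELL-PREPAREDNESS (CJS Lemma 12.1 (4) / 13.2 (1); vertices pull back by `…NewtonSetChartVertices.isVertex_of_isVertex_image_psiC`).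
-/

set_option linter.dupNamespace false -- mandated namespace of this single-conjunct summit

noncomputable section

namespace Summit.ResolutionOfSingularities.ResolutionOfSingularities.Theorems

namespace PolyDescent

open MvPowerSeries MonicDescent WildMonic Literature.RingTheory.TwoVariableSeries

variable {k : Type} [Field k]

/-! ## Slot arithmetic -/

/-- `(d!/(d−j)) · (d−j) = d!`. -/
theorem slotWeight_mul_sub' {d : ℕ} (j : Fin d) : slotWeight d j * (d - (j : ℕ)) = d.factorial := slotWeight_mul_sub j

/-- The slot weight divides `d!`. -/
theorem slotWeight_dvd_factorial {d : ℕ} (j : Fin d) : slotWeight d j ∣ d.factorial :=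
  Dvd.intro _ (slotWeight_mul_sub j)

/-- For a position every exponent `e` of `A_j` has `e₀ + e₁ ≥ d − j`. -/
theorem sub_le_sum_of_isPosT {d : ℕ} {A : Fin d → MvPowerSeries (Fin 2) k} (hA : IsPosT d A) (j : Fin d) :
    ∀ e : Fin 2 →₀ ℕ, coeff e (A j) ≠ 0 → d - (j : ℕ) ≤ e 0 + e 1 := by
  intro e he
  by_contra hlt
  push Not at hlt
  apply he
  apply coeff_of_lt_order
  refine lt_of_le_of_lt ?_ (hA j)
  have hdeg : Finsupp.degree e = e 0 + e 1 := by rw [Finsupp.degree_eq_sum]; simp [Fin.sum_univ_two]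
  rw [hdeg]; exact_mod_cast hlt.le

/-- For a position every scaled point has `P₀ + P₁ ≥ d!`. -/
theorem factorial_le_sum_of_isPosT {d : ℕ} {A : Fin d → MvPowerSeries (Fin 2) k} (hA : IsPosT d A) :
    ∀ P ∈ newtonSet A, d.factorial ≤ P 0 + P 1 :=
  fun P hP => (factorial_lt_sum_of_isPosT hA P hP).le

/-! ## The scaled Newton set under the four slotwise transports -/

/-- `u₁`-CHART: `newtonSet (blowOneT d A) = psi d! '' newtonSet A` for a position. -/
theorem newtonSet_blowOneT {d : ℕ} (A : Fin d → MvPowerSeries (Fin 2) k) (hA : IsPosT d A) :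
    newtonSet (blowOneT d A) = psi d.factorial '' newtonSet A := by
  ext P
  constructor
  · rintro ⟨j, e, he, rfl⟩
    obtain ⟨e', -, rfl, he'⟩ := exists_of_coeff_blowOne_ne_zero _ _ e he
    refine ⟨slotWeight d j • e', ⟨j, e', he', rfl⟩, ?_⟩
    rw [smul_psi, slotWeight_mul_sub]
  · rintro ⟨Q, ⟨j, e', he', rfl⟩, rfl⟩
    refine ⟨j, psi (d - (j : ℕ)) e', ?_, ?_⟩
    · show coeff (psi (d - (j : ℕ)) e') (blowOne (d - (j : ℕ)) (A j)) ≠ 0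
      rw [coeff_blowOne_psi _ _ _ (sub_le_sum_of_isPosT hA j e' he')]; exact he'
    · rw [smul_psi, slotWeight_mul_sub]

/-- `u₂`-CHART: `newtonSet (blowTwoT d A) = phiE d! '' newtonSet A` for a position. -/
theorem newtonSet_blowTwoT {d : ℕ} (A : Fin d → MvPowerSeries (Fin 2) k) (hA : IsPosT d A) :
    newtonSet (blowTwoT d A) = phiE d.factorial '' newtonSet A := by
  have hsmul : ∀ (N q : ℕ) (e : Fin 2 →₀ ℕ), N • phiE q e = phiE (N * q) (N • e) := by
    intro N q e
    refine finsupp_fin2_ext ?_ ?_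
    · simp only [Finsupp.smul_apply, smul_eq_mul, phiE_apply_zero]
    · simp only [Finsupp.smul_apply, smul_eq_mul, phiE_apply_one]
      rw [Nat.mul_sub, Nat.mul_add]
  ext P
  constructor
  · rintro ⟨j, e, he, rfl⟩
    obtain ⟨e', -, rfl, he'⟩ := exists_of_coeff_blowTwo_ne_zero _ _ e he
    refine ⟨slotWeight d j • e', ⟨j, e', he', rfl⟩, ?_⟩
    rw [hsmul, slotWeight_mul_sub]
  · rintro ⟨Q, ⟨j, e', he', rfl⟩, rfl⟩
    refine ⟨j, phiE (d - (j : ℕ)) e', ?_, ?_⟩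
    · show coeff (phiE (d - (j : ℕ)) e') (blowTwo (d - (j : ℕ)) (A j)) ≠ 0
      rw [coeff_blowTwo_phiE _ _ _ (sub_le_sum_of_isPosT hA j e' he')]; exact he'
    · rw [hsmul, slotWeight_mul_sub]

/-- CURVE `V(y,u₁)`: `newtonSet (divOneT d A)` is the shift by `(d!,0)` of `newtonSet A` (permissible label). -/
theorem newtonSet_divOneT {d : ℕ} (A : Fin d → MvPowerSeries (Fin 2) k) (hA : IsPermissibleOneT d A) :
    newtonSet (divOneT d A) = (fun P : Fin 2 →₀ ℕ => Finsupp.single 0 (P 0 - d.factorial) + Finsupp.single 1 (P 1)) '' newtonSet A := by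
  ext P
  constructor
  · rintro ⟨j, e, he, rfl⟩
    have he' : coeff (e + Finsupp.single 0 (d - (j : ℕ))) (A j) ≠ 0 := by
      change coeff e (divOne (d - (j : ℕ)) (A j)) ≠ 0 at he
      rwa [coeff_divOne] at he
    refine ⟨slotWeight d j • (e + Finsupp.single 0 (d - (j : ℕ))), ⟨j, _, he', rfl⟩, finsupp_fin2_ext ?_ ?_⟩
    · simp only [Finsupp.smul_apply, Finsupp.add_apply, Finsupp.single_apply, smul_eq_mul]
      simp
      rw [Nat.mul_add, slotWeight_mul_sub]
      omega
    · simp only [Finsupp.smul_apply, Finsupp.add_apply, Finsupp.single_apply, smul_eq_mul]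
      simp
  · rintro ⟨Q, ⟨j, e', he', rfl⟩, rfl⟩
    have hle := hA j e' he'
    refine ⟨j, Finsupp.single 0 (e' 0 - (d - (j : ℕ))) + Finsupp.single 1 (e' 1), ?_, finsupp_fin2_ext ?_ ?_⟩
    · show coeff _ (divOne (d - (j : ℕ)) (A j)) ≠ 0
      rw [coeff_divOne_shift _ _ _ hle]; exact he'
    · simp only [Finsupp.smul_apply, Finsupp.add_apply, Finsupp.single_apply, smul_eq_mul]
      simp
      rw [Nat.mul_sub, slotWeight_mul_sub]
    · simp only [Finsupp.smul_apply, Finsupp.add_apply, Finsupp.single_apply, smul_eq_mul]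
      simp

/-- CURVE `V(y,u₂)`: `newtonSet (divTwoT d A)` is the shift by `(0,d!)` (permissible label). -/
theorem newtonSet_divTwoT {d : ℕ} (A : Fin d → MvPowerSeries (Fin 2) k) (hA : IsPermissibleTwoT d A) :
    newtonSet (divTwoT d A) = (fun P : Fin 2 →₀ ℕ => Finsupp.single 0 (P 0) + Finsupp.single 1 (P 1 - d.factorial)) '' newtonSet A := by
  ext P
  constructor
  · rintro ⟨j, e, he, rfl⟩
    have he' : coeff (e + Finsupp.single 1 (d - (j : ℕ))) (A j) ≠ 0 := by
      change coeff e (divTwo (d - (j : ℕ)) (A j)) ≠ 0 at he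
      rwa [coeff_divTwo] at he
    refine ⟨slotWeight d j • (e + Finsupp.single 1 (d - (j : ℕ))), ⟨j, _, he', rfl⟩, finsupp_fin2_ext ?_ ?_⟩
    · simp only [Finsupp.smul_apply, Finsupp.add_apply, Finsupp.single_apply, smul_eq_mul]
      simp
    · simp only [Finsupp.smul_apply, Finsupp.add_apply, Finsupp.single_apply, smul_eq_mul]
      simp
      rw [Nat.mul_add, slotWeight_mul_sub]
      omega
  · rintro ⟨Q, ⟨j, e', he', rfl⟩, rfl⟩
    have hle := hA j e' he'
    refine ⟨j, Finsupp.single 0 (e' 0) + Finsupp.single 1 (e' 1 - (d - (j : ℕ))), ?_, finsupp_fin2_ext ?_ ?_⟩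
    · show coeff _ (divTwo (d - (j : ℕ)) (A j)) ≠ 0
      rw [coeff_divTwo_shift _ _ _ hle]; exact he'
    · simp only [Finsupp.smul_apply, Finsupp.add_apply, Finsupp.single_apply, smul_eq_mul]
      simp
    · simp only [Finsupp.smul_apply, Finsupp.add_apply, Finsupp.single_apply, smul_eq_mul]
      simp
      rw [Nat.mul_sub, slotWeight_mul_sub]

/-- The shift coordinates on a `V(y,u₁)`-permissible label: `σ P 0 + d! = P 0`. -/
theorem shiftOneF_fst {d : ℕ} {A : Fin d → MvPowerSeries (Fin 2) k} (hA : IsPermissibleOneT d A) :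
    ∀ P ∈ newtonSet A, (Finsupp.single 0 (P 0 - d.factorial) + Finsupp.single 1 (P 1) : Fin 2 →₀ ℕ) 0 + d.factorial = P 0 := by
  rintro P ⟨j, e, he, rfl⟩
  have h := hA j e he
  simp only [Finsupp.smul_apply, Finsupp.add_apply, Finsupp.single_apply, smul_eq_mul]
  simp
  have : d.factorial ≤ slotWeight d j * e 0 := by
    rw [← slotWeight_mul_sub j]; exact Nat.mul_le_mul_left _ h
  omega

/-- … and `σ P 1 = P 1`. -/
theorem shiftOneF_snd (d : ℕ) (A : Fin d → MvPowerSeries (Fin 2) k) :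
    ∀ P ∈ newtonSet A, (Finsupp.single 0 (P 0 - d.factorial) + Finsupp.single 1 (P 1) : Fin 2 →₀ ℕ) 1 = P 1 := by
  intro P _
  simp only [Finsupp.add_apply, Finsupp.single_apply]
  simp

/-- The second shift: `σ P 0 = P 0`. -/
theorem shiftTwoF_fst (d : ℕ) (A : Fin d → MvPowerSeries (Fin 2) k) :
    ∀ P ∈ newtonSet A, (Finsupp.single 0 (P 0) + Finsupp.single 1 (P 1 - d.factorial) : Fin 2 →₀ ℕ) 0 = P 0 := by
  intro P _
  simp only [Finsupp.add_apply, Finsupp.single_apply]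
  simp

/-- … and `σ P 1 + d! = P 1` on a `V(y,u₂)`-permissible label. -/
theorem shiftTwoF_snd {d : ℕ} {A : Fin d → MvPowerSeries (Fin 2) k} (hA : IsPermissibleTwoT d A) :
    ∀ P ∈ newtonSet A, (Finsupp.single 0 (P 0) + Finsupp.single 1 (P 1 - d.factorial) : Fin 2 →₀ ℕ) 1 + d.factorial = P 1 := by
  rintro P ⟨j, e, he, rfl⟩
  have h := hA j e he
  simp only [Finsupp.smul_apply, Finsupp.add_apply, Finsupp.single_apply, smul_eq_mul]
  simp
  have : d.factorial ≤ slotWeight d j * e 1 := by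
    rw [← slotWeight_mul_sub j]; exact Nat.mul_le_mul_left _ h
  omega

/-! ## Vertex coefficients and solvability are CARRIED by the four transports -/

/-- Slot divisibility of `psi d! P` (order `≥ d!`). -/
theorem forall_slotWeight_dvd_psi_iff {d : ℕ} (j : Fin d) {P : Fin 2 →₀ ℕ} (hP : d.factorial ≤ P 0 + P 1) :
    (∀ i, slotWeight d j ∣ psi d.factorial P i) ↔ ∀ i, slotWeight d j ∣ P i := by
  have hw := slotWeight_dvd_factorial j
  constructor
  · intro h i
    have h0 := h 0; have h1 := h 1
    rw [psi_apply_zero] at h0; rw [psi_apply_one] at h1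
    fin_cases i
    · have : P 0 = (P 0 + P 1 - d.factorial) + d.factorial - P 1 := by omega
      show slotWeight d j ∣ P 0
      rw [this]; exact Nat.dvd_sub (Nat.dvd_add h0 hw) h1
    · exact h1
  · intro h i
    fin_cases i
    · show slotWeight d j ∣ psi d.factorial P 0
      rw [psi_apply_zero]; exact Nat.dvd_sub (Nat.dvd_add (h 0) (h 1)) hw
    · show slotWeight d j ∣ psi d.factorial P 1
      rw [psi_apply_one]; exact h 1

/-- VERTEX COEFFICIENTS UNDER THE `u₁`-CHART: `vertexCoeff (blowOneT A) (psi d! P) j = vertexCoeff A P j` (order `≥ d!`). -/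
theorem vertexCoeff_blowOneT {d : ℕ} (A : Fin d → MvPowerSeries (Fin 2) k) {P : Fin 2 →₀ ℕ} (hP : d.factorial ≤ P 0 + P 1) (j : Fin d) :
    vertexCoeff d (blowOneT d A) (psi d.factorial P) j = vertexCoeff d A P j := by
  by_cases hdvd : ∀ i, slotWeight d j ∣ P i
  · have hdvd' := (forall_slotWeight_dvd_psi_iff j hP).mpr hdvd
    rw [vertexCoeff_of_dvd _ hdvd', vertexCoeff_of_dvd _ hdvd]
    have hw := slotWeight_pos j
    set e : Fin 2 →₀ ℕ := Finsupp.single 0 (P 0 / slotWeight d j) + Finsupp.single 1 (P 1 / slotWeight d j) with he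
    have he0 : e 0 = P 0 / slotWeight d j := by simp [he]
    have he1 : e 1 = P 1 / slotWeight d j := by simp [he]
    have hsum : d - (j : ℕ) ≤ e 0 + e 1 := by
      rw [he0, he1]
      have h0 := Nat.div_mul_cancel (hdvd 0)
      have h1 := Nat.div_mul_cancel (hdvd 1)
      have hws := slotWeight_mul_sub j
      by_contra hlt
      push Not at hlt
      have : (P 0 / slotWeight d j + P 1 / slotWeight d j + 1) * slotWeight d j ≤ (d - (j : ℕ)) * slotWeight d j :=
        Nat.mul_le_mul_right _ hlt
      rw [Nat.add_mul, Nat.add_mul, h0, h1, one_mul, mul_comm (d - (j : ℕ)), hws] at this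
      omega
    have hidx : (Finsupp.single 0 (psi d.factorial P 0 / slotWeight d j) + Finsupp.single 1 (psi d.factorial P 1 / slotWeight d j) :
        Fin 2 →₀ ℕ) = psi (d - (j : ℕ)) e := by
      refine finsupp_fin2_ext ?_ ?_
      · simp only [Finsupp.add_apply, Finsupp.single_apply, psi_apply_zero, he0, he1]
        simp
        have h0 := Nat.div_mul_cancel (hdvd 0)
        have h1 := Nat.div_mul_cancel (hdvd 1)
        have hws := slotWeight_mul_sub j
        apply Nat.eq_of_mul_eq_mul_right hw
        rw [Nat.div_mul_cancel (Nat.dvd_sub (Nat.dvd_add (hdvd 0) (hdvd 1)) (slotWeight_dvd_factorial j)),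
          Nat.sub_mul, Nat.add_mul, h0, h1, mul_comm (d - (j : ℕ)), hws]
      · simp only [Finsupp.add_apply, Finsupp.single_apply, psi_apply_one, he1]
        simp
    rw [hidx]
    exact coeff_blowOne_psi _ _ _ hsum
  · rw [vertexCoeff_of_not_dvd _ (fun h => hdvd ((forall_slotWeight_dvd_psi_iff j hP).mp h)), vertexCoeff_of_not_dvd _ hdvd]

/-- Integrality under the `u₁`-chart. -/
theorem isIntegral_psi_iff {d : ℕ} {P : Fin 2 →₀ ℕ} (hP : d.factorial ≤ P 0 + P 1) :
    IsIntegral d (psi d.factorial P) ↔ IsIntegral d P :=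
  PureDescent.forall_dvd_psi_iff d.factorial hP

/-- SOLVABILITY IS CARRIED by the `u₁`-chart. -/
theorem solvable_blowOneT_iff {d : ℕ} (A : Fin d → MvPowerSeries (Fin 2) k) {P : Fin 2 →₀ ℕ} (hP : d.factorial ≤ P 0 + P 1) :
    Solvable d (blowOneT d A) (psi d.factorial P) ↔ Solvable d A P := by
  unfold Solvable
  rw [isIntegral_psi_iff hP]
  simp only [vertexCoeff_blowOneT A hP]

/-- WELL-PREPAREDNESS PERSISTS under the `u₁`-chart (CJS Lemma 12.1 (4) / 13.2 (1)). -/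
theorem wellPrepared_blowOneT {d : ℕ} (A : Fin d → MvPowerSeries (Fin 2) k) (hA : IsPosT d A) (hWP : WellPrepared d A) :
    WellPrepared d (blowOneT d A) := by
  intro Q hQ
  have hQmem : Q ∈ newtonSet (blowOneT d A) := hQ.1
  rw [newtonSet_blowOneT A hA] at hQmem hQ
  obtain ⟨P, hP, rfl⟩ := hQmem
  have hsum := factorial_le_sum_of_isPosT hA
  have hv : IsVertex (newtonSet A) P := isVertex_of_isVertex_image_psiC hsum hP hQ
  rw [solvable_blowOneT_iff A (hsum P hP)]
  exact hWP P hv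

end PolyDescent

end Summit.ResolutionOfSingularities.ResolutionOfSingularities.Theorems

end
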